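import Mathlib
import Summits.NavierStokesRegularity.NavierStokesRegularity.Theorems.EulerZoomLiouvillePowerGaugeEulerLiouvilleCondenserThinWindowGap
import Summits.NavierStokesRegularity.NavierStokesRegularity.Theorems.EulerZoomLiouvillePowerGaugeEulerLiouvilleNeedleFrobeniusInput
import Summits.NavierStokesRegularity.NavierStokesRegularity.Theorems.StretchingWellBindingDssProfileBindingTestFields

/-!
# THEOREM K⁗ — THE GLUE: `MomentumGapLiouville` from a PER-WINDOW FROBENIUS COUNT (nsreg-p2 g37 ROUND-47 «WHO HOLDS THE
RIDGE» §3/§4, assembly card (H47b) → (K⁗); seat ns-sfl-p1 g7 = K⁗ assembler, keyed 2026-08-29T00:46Z)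

Width piece for crux `EulerZoomLiouville.PowerGaugeEulerLiouville` (stmt-NavierStokesRegularity-19832), by name under LEAD 19832
(ns-typeII-p2); `--supports stmt-NavierStokesRegularity-19832 --as helper`.

This file is THEOREM K″'s machine (`Condenser.selfSimilar_ae_eq_zero_of_thinWindowSmallTypeGradientC2`, p682751) re-run on the
FROBENIUS shell energy `F(t) = ∫_{B(0,t)} |DV|_F²` (budget `C_E t^{1−ρ}` from the tree's (G_F)
`NeedleThinCore.selfSimilar_needle_input_frobenius`, ns-ezl-w2 g5) with the per-window condenser (B″_g) replaced by a HYPOTHESIS —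
the PER-WINDOW FROBENIUS COUNT `hW` with an amplification factor `β ρ > 0` — which is exactly what the R47 per-height core
((SR)+(I)+(H47a)+(M2)–(M9), packed by the (B″_A)-type slicing + `topIsWorstExceptionalSet`) must deliver.  The text of `hW`
(dynamic form, binder-for-binder what this glue consumes): for `ρ ∈ (0,½]`, constants `C_A, C_E > 0`, a window ratio `q ∈ (1,2]`,
a loss `θ ∈ (0,1)`, a `C²` profile `(V,P)` of the self-similar Euler equation with centre `0` and rate `γ = 1/(2+ρ)` obeying the ball
budgets `∫_{B(0,L)}‖V‖² ≤ C_A L^{1−2ρ}` (`L > 0`) and `∫_{B(0,L)}|DV|_F² ≤ C_E L^{1−ρ}` (`L ≥ 1`), and a bound `M` on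
`|ℋ₀ − P(0)|`: there is `R₁` such that for every globally Lipschitz `C¹` cut-off copy `V_c = V` on `B(0,(q+1)ℓ)`, `ℓ ≥ R₁`, every
shell budget `S ≥ ∫_{B(0,qℓ) ∩ {ℓ ≤ ‖x‖}}|DV|_F²`, and every backward orbit of `V_c` from a label `‖y‖ < ℓ` with Bernoulli floor
`ℋ(y) ≥ ℋ₀` reaching `‖·‖ ≥ qℓ`, some `z ∈ B(0,qℓ)` has `‖DV(z)‖ ≥ exp(θ·β·2πγ²(q³−1)ℓ³/(3S))`.

* `gapLiouville_of_windowCount` — for any `β > 0`: `hW` with factor `β` + the crux frame + `c′ < β·κ⋆⋆(c,ρ)` at all large radii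
  ⇒ `u = 0` a.e.;  labels: `R_in = ‖x‖+1` FIXED, `ℋ₀ = min_{B̄(0,R_in)} ℋ` a number (R47 §1), exits from `B(0,R_in)` through every
  sphere `qℓ` (K′'s `curl_eq_zero_of_noexit` with `Λ = qℓ/R_in`), (W2) `telescopingBudget_of`, `thinWindow_absurd_beta`;
* `momentumGapLiouville_of_windowCount` — `β ρ = 14/9 + ρ`: the conclusion is `NsregP2.R47.MomentumGapLiouville`
  (r47/Sketch47.lean fea44084dd39e0a7) VERBATIM.  K⁗ lands `--requires nothing` the moment `hW` is a tree theorem.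
* `setIntegral_frobeniusNormSq_ball_le` — the Bochner ball budget from the weighted Frobenius budget (twin of
  `NeedleRace.lintegral_fderiv_sq_closedBall_le`).

HONEST FRAMING: a CONDITIONAL assembly on the MODEL lattice (hypothetical exactly self-similar `C²` members of crux E's class); the
hypothesis `hW` is NOT proved here; nothing here proves the crux E (19832 OPEN), any door Target, or Navier–Stokes regularity.
[nsreg-p2 ROUND-47 §3; cite: ConstantinIgnatovaVicol2026Putative, §3.4.1; folklore (length–area method)]
-/

noncomputable section

open Set Filter Topology Metric Function MeasureTheory Real
open scoped RealInnerProductSpace NNReal ENNReal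

set_option linter.dupNamespace false

namespace Summit.NavierStokesRegularity.NavierStokesRegularity.Theorems.PowerGaugeEulerLiouville.Condenser

open Literature.Analysis Literature.Analysis.FluidPDE
open Summit.NavierStokesRegularity.NavierStokesRegularity.Theorems.PowerGaugeEulerLiouville

/-! ## Bookkeeping -/

/-- **Ball budget, Frobenius form**: if `∫⁻ |DV|_F² ‖y‖^{ρ−1} ≤ E` (`ρ < 1`, `0 ≤ E`) then for `L ≥ 1`
`∫_{B(0,L)} |DV|_F² ≤ E · L^{1−ρ}` (`‖y‖^{ρ−1} ≥ L^{ρ−1}` on the ball). [folklore] -/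
theorem setIntegral_frobeniusNormSq_ball_le {V : EuclideanSpace ℝ (Fin 3) → EuclideanSpace ℝ (Fin 3)} (hV : ContDiff ℝ 1 V)
    {ρ : ℝ} (hρ1 : ρ < 1) {E : ℝ} (hE0 : 0 ≤ E)
    (hE : ∫⁻ y, ENNReal.ofReal (frobeniusNormSq (fderiv ℝ V y)) * ENNReal.ofReal (‖y‖ ^ (ρ - 1)) ≤ ENNReal.ofReal E)
    {L : ℝ} (hL : 1 ≤ L) :
    ∫ z in ball (0 : EuclideanSpace ℝ (Fin 3)) L, frobeniusNormSq (fderiv ℝ V z) ≤ E * L ^ (1 - ρ) := by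
  have hL0 : 0 < L := by linarith
  have hpt : ∀ᵐ z ∂(volume.restrict (ball (0 : EuclideanSpace ℝ (Fin 3)) L)),
      ENNReal.ofReal (frobeniusNormSq (fderiv ℝ V z)) ≤
        ENNReal.ofReal (frobeniusNormSq (fderiv ℝ V z)) * ENNReal.ofReal (‖z‖ ^ (ρ - 1)) * ENNReal.ofReal (L ^ (1 - ρ)) := by
    have h0 : ({0}ᶜ : Set (EuclideanSpace ℝ (Fin 3))) ∈ ae (volume.restrict (ball (0 : EuclideanSpace ℝ (Fin 3)) L)) :=
      ae_restrict_of_ae (compl_mem_ae_iff.2 (measure_singleton 0))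
    filter_upwards [h0, ae_restrict_mem measurableSet_ball] with z hz hzL
    have hz0 : 0 < ‖z‖ := norm_pos_iff.2 hz
    have hzL' : ‖z‖ ≤ L := (mem_ball_zero_iff.1 hzL).le
    have h2 : 1 ≤ ‖z‖ ^ (ρ - 1) * L ^ (1 - ρ) := by
      have h21 : L ^ (ρ - 1) ≤ ‖z‖ ^ (ρ - 1) := Real.rpow_le_rpow_of_nonpos hz0 hzL' (by linarith)
      have h22 : L ^ (ρ - 1) * L ^ (1 - ρ) = 1 := by
        rw [← Real.rpow_add hL0, show ρ - 1 + (1 - ρ) = 0 by ring, Real.rpow_zero]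
      have h23 : 0 ≤ L ^ (1 - ρ) := Real.rpow_nonneg hL0.le _
      nlinarith
    have h3 : (1 : ℝ≥0∞) ≤ ENNReal.ofReal (‖z‖ ^ (ρ - 1)) * ENNReal.ofReal (L ^ (1 - ρ)) := by
      rw [← ENNReal.ofReal_mul (Real.rpow_nonneg (norm_nonneg _) _), ← ENNReal.ofReal_one]
      exact ENNReal.ofReal_le_ofReal h2
    calc ENNReal.ofReal (frobeniusNormSq (fderiv ℝ V z)) = ENNReal.ofReal (frobeniusNormSq (fderiv ℝ V z)) * 1 :=
          (mul_one _).symm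
      _ ≤ ENNReal.ofReal (frobeniusNormSq (fderiv ℝ V z)) *
          (ENNReal.ofReal (‖z‖ ^ (ρ - 1)) * ENNReal.ofReal (L ^ (1 - ρ))) := mul_le_mul' le_rfl h3
      _ = _ := by rw [mul_assoc]
  have hlin : ∫⁻ z in ball (0 : EuclideanSpace ℝ (Fin 3)) L, ENNReal.ofReal (frobeniusNormSq (fderiv ℝ V z)) ≤
      ENNReal.ofReal (E * L ^ (1 - ρ)) := by
    calc ∫⁻ z in ball (0 : EuclideanSpace ℝ (Fin 3)) L, ENNReal.ofReal (frobeniusNormSq (fderiv ℝ V z))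
        ≤ ∫⁻ z in ball (0 : EuclideanSpace ℝ (Fin 3)) L, ENNReal.ofReal (frobeniusNormSq (fderiv ℝ V z)) *
            ENNReal.ofReal (‖z‖ ^ (ρ - 1)) * ENNReal.ofReal (L ^ (1 - ρ)) := lintegral_mono_ae hpt
      _ = (∫⁻ z in ball (0 : EuclideanSpace ℝ (Fin 3)) L, ENNReal.ofReal (frobeniusNormSq (fderiv ℝ V z)) *
            ENNReal.ofReal (‖z‖ ^ (ρ - 1))) * ENNReal.ofReal (L ^ (1 - ρ)) := by
          rw [lintegral_mul_const' _ _ ENNReal.ofReal_ne_top]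
      _ ≤ (∫⁻ z, ENNReal.ofReal (frobeniusNormSq (fderiv ℝ V z)) * ENNReal.ofReal (‖z‖ ^ (ρ - 1))) *
            ENNReal.ofReal (L ^ (1 - ρ)) := by
          gcongr
          exact Measure.restrict_le_self
      _ ≤ ENNReal.ofReal E * ENNReal.ofReal (L ^ (1 - ρ)) := by gcongr
      _ = ENNReal.ofReal (E * L ^ (1 - ρ)) := by rw [← ENNReal.ofReal_mul hE0]
  have hB : 0 ≤ E * L ^ (1 - ρ) := mul_nonneg hE0 (Real.rpow_nonneg hL0.le _)
  rw [integral_eq_lintegral_of_nonneg_ae (Filter.Eventually.of_forall fun x => frobeniusNormSq_nonneg _)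
    (DssBinding.continuous_frobeniusNormSq_fderiv hV).aestronglyMeasurable]
  exact ENNReal.toReal_le_of_le_ofReal hB hlin

/-- The final arithmetic of THEOREM K⁗: `a = θβ2πγ²(q³−1)/(3c'Q) ≤ C_E(q^{1−ρ}−1)` is incompatible with `c'Q < θκ`,
`κ(1−ρ)C_E = β·2πγ²` (`Q = q^{2+ρ} > 0`, `q > 1`, `0 ≤ ρ < 1`; Bernoulli `q^{1−ρ} ≤ 1 + (1−ρ)(q−1)`, `q³−1 ≥ 3(q−1)`). [folklore] -/
theorem thinWindow_absurd_beta {θ γ q c' Q CE κ ρ β : ℝ} (hθ : 0 < θ) (hβ : 0 < β) (hq : 1 < q) (hc' : 0 < c') (hQ : 0 < Q)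
    (hCE : 0 < CE) (hρ : 0 ≤ ρ) (hρ1 : ρ < 1)
    (hκid : κ * ((1 - ρ) * CE) = β * (2 * Real.pi * γ ^ 2)) (hqθ : c' * Q < θ * κ)
    (hW : θ * (β * (2 * Real.pi * γ ^ 2 * (q ^ 3 - 1))) / (3 * c' * Q) ≤ CE * (q ^ (1 - ρ) - 1)) : False := by
  have hπ : 0 < Real.pi := Real.pi_pos
  have hB := rpow_one_add_le_one_add_mul_self (s := q - 1) (by linarith) (p := 1 - ρ) (by linarith) (by linarith)
  rw [show (1 : ℝ) + (q - 1) = q by ring] at hB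
  have hq3 : 3 * (q - 1) ≤ q ^ 3 - 1 := by nlinarith [mul_pos (sub_pos.2 hq) (sub_pos.2 hq)]
  rw [div_le_iff₀ (by positivity)] at hW
  have hN : 0 ≤ β * (2 * Real.pi * γ ^ 2) := by positivity
  have h1 : CE * (q ^ (1 - ρ) - 1) * (3 * c' * Q) ≤ CE * ((1 - ρ) * (q - 1)) * (3 * c' * Q) :=
    mul_le_mul_of_nonneg_right (mul_le_mul_of_nonneg_left (by linarith) hCE.le) (by positivity)
  have h2 : θ * (β * (2 * Real.pi * γ ^ 2) * (3 * (q - 1))) ≤ θ * (β * (2 * Real.pi * γ ^ 2 * (q ^ 3 - 1))) := by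
    have : β * (2 * Real.pi * γ ^ 2) * (3 * (q - 1)) ≤ β * (2 * Real.pi * γ ^ 2) * (q ^ 3 - 1) :=
      mul_le_mul_of_nonneg_left hq3 hN
    have e : β * (2 * Real.pi * γ ^ 2 * (q ^ 3 - 1)) = β * (2 * Real.pi * γ ^ 2) * (q ^ 3 - 1) := by ring
    rw [e]; exact mul_le_mul_of_nonneg_left this hθ.le
  have h3 : θ * (β * (2 * Real.pi * γ ^ 2)) * (3 * (q - 1)) ≤ c' * Q * ((1 - ρ) * CE) * (3 * (q - 1)) := by
    have := (h2.trans hW).trans h1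
    nlinarith [this]
  have h4 : θ * (β * (2 * Real.pi * γ ^ 2)) ≤ c' * Q * ((1 - ρ) * CE) := le_of_mul_le_mul_right h3 (by linarith)
  have h5 : c' * Q * ((1 - ρ) * CE) < θ * κ * ((1 - ρ) * CE) :=
    mul_lt_mul_of_pos_right hqθ (mul_pos (by linarith) hCE)
  rw [mul_assoc θ κ, hκid] at h5
  linarith

/-! ## THEOREM K⁗ from the per-window count -/

/-- **THE GAP LIOUVILLE THEOREM FROM A PER-WINDOW FROBENIUS COUNT WITH FACTOR `β`.**  See the module docstring: `hW` is the
per-window count (dynamic form) with amplification `β > 0`; the rest is the crux frame of K″/K⁗ with the threshold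
`c′ < β · 2π/((1−ρ)²(2+ρ)c)`. [nsreg-p2 ROUND-47 §3; cite: ConstantinIgnatovaVicol2026Putative, §3.4.1; folklore] -/
theorem gapLiouville_of_windowCount {ρ β : ℝ} (hρ : 0 < ρ) (hρ1 : ρ ≤ 1 / 2) (hβ : 0 < β)
    (hW : ∀ (C_A C_E q θ : ℝ), 0 < C_A → 0 < C_E → 1 < q → q ≤ 2 → 0 < θ → θ < 1 →
      ∀ (V : EuclideanSpace ℝ (Fin 3) → EuclideanSpace ℝ (Fin 3)) (P : EuclideanSpace ℝ (Fin 3) → ℝ),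
        ContDiff ℝ 2 V → IsSelfSimilarEulerProfile (1 / (2 + ρ)) 0 V P →
        (∀ L : ℝ, 0 < L → ∫ x in ball (0 : EuclideanSpace ℝ (Fin 3)) L, ‖V x‖ ^ 2 ≤ C_A * L ^ (1 - 2 * ρ)) →
        (∀ L : ℝ, 1 ≤ L → ∫ x in ball (0 : EuclideanSpace ℝ (Fin 3)) L, frobeniusNormSq (fderiv ℝ V x) ≤ C_E * L ^ (1 - ρ)) →
        ∀ M : ℝ, 0 ≤ M → ∃ R₁ : ℝ, 0 < R₁ ∧
          ∀ (Vc : EuclideanSpace ℝ (Fin 3) → EuclideanSpace ℝ (Fin 3)) (K H₀ : ℝ), ContDiff ℝ 1 Vc →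
            (∀ y, ‖fderiv ℝ Vc y‖ ≤ K) → |H₀ - P 0| ≤ M →
            ∀ ℓ S : ℝ, R₁ ≤ ℓ → 0 < S →
              (∀ y ∈ ball (0 : EuclideanSpace ℝ (Fin 3)) ((q + 1) * ℓ), Vc y = V y) →
              (∫ x in ball (0 : EuclideanSpace ℝ (Fin 3)) (q * ℓ) ∩ {x : EuclideanSpace ℝ (Fin 3) | ℓ ≤ ‖x‖},
                  frobeniusNormSq (fderiv ℝ V x) ≤ S) →
              ∀ (y : EuclideanSpace ℝ (Fin 3)) (L : ℝ), 0 ≤ L → ‖y‖ < ℓ →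
                H₀ ≤ selfSimilarBernoulli (1 / (2 + ρ)) 0 V P y →
                q * ℓ ≤ ‖ODE.evolutionMap (fun _ : ℝ => selfSimilarTransport (1 / (2 + ρ)) 0 Vc) 0 (-L) y‖ →
                ∃ z ∈ ball (0 : EuclideanSpace ℝ (Fin 3)) (q * ℓ),
                  Real.exp (θ * (β * (2 * Real.pi * (1 / (2 + ρ)) ^ 2 * (q ^ 3 - 1) * ℓ ^ 3 / (3 * S)))) ≤ ‖fderiv ℝ V z‖)
    {u : ℝ → EuclideanSpace ℝ (Fin 3) → EuclideanSpace ℝ (Fin 3)} {p : ℝ → EuclideanSpace ℝ (Fin 3) → ℝ}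
    {H : ℝ → EuclideanSpace ℝ (Fin 3) → EuclideanSpace ℝ (Fin 3) →L[ℝ] EuclideanSpace ℝ (Fin 3)} {c : ℝ≥0}
    (hc : 0 < (c : ℝ))
    (hsw : IsSuitableWeakSolutionOn (slab (EuclideanSpace ℝ (Fin 3)) (Iio 0) isOpen_Iio) 0 0 u p)
    (hH : HasWeakSpatialGradientOn (slab (EuclideanSpace ℝ (Fin 3)) (Iio 0) isOpen_Iio) u H)
    (hgauge : ∀ a : ℝ, 0 < a →
      ENNReal.ofReal (a ^ (2 * ρ)) * cknA a (0 : ℝ × EuclideanSpace ℝ (Fin 3)) u +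
          ENNReal.ofReal (a ^ ρ) * cknE a (0 : ℝ × EuclideanSpace ℝ (Fin 3)) H +
        ENNReal.ofReal (a ^ (2 * ρ)) * cknD a (0 : ℝ × EuclideanSpace ℝ (Fin 3)) p ≤ (c : ℝ≥0∞))
    {V : EuclideanSpace ℝ (Fin 3) → EuclideanSpace ℝ (Fin 3)} {P : EuclideanSpace ℝ (Fin 3) → ℝ}
    (hu : ∀ τ : ℝ, τ < 0 → u τ = selfSimilarCollapse (1 / (2 + ρ)) 0 V τ)
    (hp : ∀ τ : ℝ, τ < 0 → p τ = selfSimilarCollapsePressure (1 / (2 + ρ)) 0 P τ)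
    (hV : ContDiff ℝ 2 V)
    (hgrad : ∃ c' : ℝ, c' < β * (2 * Real.pi / ((1 - ρ) ^ 2 * (2 + ρ) * (c : ℝ))) ∧
      ∃ R₀ : ℝ, ∀ R : ℝ, R₀ ≤ R →
        ∀ z ∈ ball (0 : EuclideanSpace ℝ (Fin 3)) R, ‖fderiv ℝ V z‖ ≤ Real.exp (c' * R ^ (2 + ρ))) :
    uncurry u =ᵐ[volume.restrict (Iio (0 : ℝ) ×ˢ (univ : Set (EuclideanSpace ℝ (Fin 3))))] 0 := by
  obtain ⟨c₀, hc₀κ, R₀, hgrad⟩ := hgrad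
  have hπ : 0 < Real.pi := Real.pi_pos
  have hρ1' : ρ < 1 := by linarith
  have h2ρ : (0 : ℝ) < 2 + ρ := by linarith
  have h1ρ : (0 : ℝ) < 1 - ρ := by linarith
  have hγ : (0 : ℝ) < 1 / (2 + ρ) := one_div_pos.2 h2ρ
  have hγ2 : 1 / (2 + ρ) < 1 / 2 := one_div_lt_one_div_of_lt two_pos (by linarith)
  have hV1 : ContDiff ℝ 1 V := hV.of_le (by norm_num)
  -- ### a classical pressure for the profile
  have hA : ∀ a : ℝ, 0 < a → ENNReal.ofReal (a ^ (2 * ρ)) *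
      cknA a (0 : ℝ × EuclideanSpace ℝ (Fin 3)) u ≤ (c : ℝ≥0∞) :=
    fun a ha => le_trans (le_trans le_self_add le_self_add) (hgauge a ha)
  have hD : ∀ a : ℝ, 0 < a → ENNReal.ofReal (a ^ (2 * ρ)) *
      cknD a (0 : ℝ × EuclideanSpace ℝ (Fin 3)) p ≤ (c : ℝ≥0∞) :=
    fun a ha => le_trans le_add_self (hgauge a ha)
  have hpm : AEStronglyMeasurable (uncurry p)
      (volume.restrict (Iio (0 : ℝ) ×ˢ (univ : Set (EuclideanSpace ℝ (Fin 3))))) := by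
    have := hsw.distributional.2.2.1.aestronglyMeasurable
    simpa [slab] using this
  have hPm := aestronglyMeasurable_pressureProfile hpm hp
  have hDprof := profile_pressure_weight_of_gaugeD hρ hρ1' hpm hp hD
  have hP1 : LocallyIntegrable P volume :=
    EnergySaturation.locallyIntegrable_pressure_of_weight hρ1' hPm
      (ENNReal.mul_ne_top ENNReal.ofReal_ne_top ENNReal.coe_ne_top) hDprof
  obtain ⟨P', hprof⟩ :=
    WeakToClassical.exists_isSelfSimilarEulerProfile_of_contDiff hsw.distributional hu hp hV hP1
  -- ### the class budgets of the profile on balls: amplitude, and FROBENIUS energy (G_F)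
  obtain ⟨hA', -⟩ := NeedleThinCore.selfSimilar_needle_inputs hρ hρ1' hsw hH hgauge hu hp hV1
  have hEF := NeedleThinCore.selfSimilar_needle_input_frobenius hρ hρ1' hsw hH hgauge hu hp hV1
  obtain ⟨CA, hCA⟩ : ∃ CA : ℝ, CA = (c : ℝ) := ⟨_, rfl⟩
  obtain ⟨CE, hCE⟩ : ∃ CE : ℝ, CE = (1 - ρ) / (2 + ρ) * (c : ℝ) := ⟨_, rfl⟩
  have hE0 : 0 ≤ (1 - ρ) / (2 + ρ) * (c : ℝ) := by positivity
  have hCApos : 0 < CA := by rw [hCA]; exact hc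
  have hCEpos : 0 < CE := by rw [hCE]; positivity
  have hbA : ∀ r : ℝ, 0 < r →
      ∫ x in ball (0 : EuclideanSpace ℝ (Fin 3)) r, ‖V x‖ ^ 2 ≤ CA * r ^ (1 - 2 * ρ) := by
    intro r hr
    have hX : 0 ≤ CA * r ^ (1 - 2 * ρ) := by positivity
    refine setIntegral_sq_le_of_lintegral hV.continuous hX ((hA' r hr).trans ?_)
    rw [hCA, ← ENNReal.ofReal_coe_nnreal, ← ENNReal.ofReal_mul (NNReal.coe_nonneg c)]
  have hbE : ∀ r : ℝ, 1 ≤ r →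
      ∫ x in ball (0 : EuclideanSpace ℝ (Fin 3)) r, frobeniusNormSq (fderiv ℝ V x) ≤ CE * r ^ (1 - ρ) := by
    intro r hr
    rw [hCE]
    exact setIntegral_frobeniusNormSq_ball_le hV1 hρ1' hE0 hEF hr
  -- ### the threshold `β κ⋆⋆`, WLOG `c' > 0`, the parameters `θ`, `q`
  obtain ⟨κss, hκss⟩ : ∃ κss : ℝ, κss = β * (2 * Real.pi / ((1 - ρ) ^ 2 * (2 + ρ) * (c : ℝ))) := ⟨_, rfl⟩
  rw [← hκss] at hc₀κ
  have hκss0 : 0 < κss := by rw [hκss]; positivity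
  have hκid : κss * ((1 - ρ) * CE) = β * (2 * Real.pi * (1 / (2 + ρ)) ^ 2) := by
    rw [hκss, hCE]
    field_simp
  obtain ⟨c', hc'def⟩ : ∃ c' : ℝ, c' = max c₀ (κss / 2) := ⟨_, rfl⟩
  have hc'pos : 0 < c' := by rw [hc'def]; exact lt_max_of_lt_right (by linarith)
  have hc'κ : c' < κss := by rw [hc'def]; exact max_lt hc₀κ (by linarith)
  have hc₀c' : c₀ ≤ c' := by rw [hc'def]; exact le_max_left _ _
  obtain ⟨θ, hθdef⟩ : ∃ θ : ℝ, θ = (1 + c' / κss) / 2 := ⟨_, rfl⟩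
  have hcκ : c' / κss < 1 := (div_lt_one hκss0).2 hc'κ
  have hcκ0 : 0 < c' / κss := div_pos hc'pos hκss0
  have hθ0 : 0 < θ := by rw [hθdef]; positivity
  have hθ1 : θ < 1 := by rw [hθdef]; linarith
  have hθc : c' < θ * κss := by
    have : c' / κss < θ := by rw [hθdef]; linarith
    rwa [div_lt_iff₀ hκss0] at this
  obtain ⟨q, hq, hq2, hqθ⟩ := exists_window_ratio (ρ := ρ) h2ρ hθc
  have hq0 : 0 < q := by linarith
  have hQ : 0 < q ^ (2 + ρ) := Real.rpow_pos_of_pos hq0 _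
  -- the window constant `a` and the Frobenius counting function `F`
  obtain ⟨a, hadef⟩ : ∃ a : ℝ, a = θ * (β * (2 * Real.pi * (1 / (2 + ρ)) ^ 2 * (q ^ 3 - 1))) / (3 * c' * q ^ (2 + ρ)) :=
    ⟨_, rfl⟩
  have hq3 : 0 < q ^ 3 - 1 := by nlinarith [pow_lt_pow_left₀ hq zero_le_one three_ne_zero]
  have hapos : 0 < a := by rw [hadef]; positivity
  set F : ℝ → ℝ := fun t => ∫ z in ball (0 : EuclideanSpace ℝ (Fin 3)) t, frobeniusNormSq (fderiv ℝ V z) with hF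
  have hDVc : Continuous fun z => frobeniusNormSq (fderiv ℝ V z) := DssBinding.continuous_frobeniusNormSq_fderiv hV1
  have hFint : ∀ t : ℝ, IntegrableOn (fun z => frobeniusNormSq (fderiv ℝ V z)) (ball (0 : EuclideanSpace ℝ (Fin 3)) t) volume :=
    fun t => (hDVc.continuousOn.integrableOn_compact (isCompact_closedBall 0 t)).mono_set ball_subset_closedBall
  have hF0 : ∀ t, 0 ≤ F t := fun t => setIntegral_nonneg measurableSet_ball fun z _ => frobeniusNormSq_nonneg _
  -- the Bernoulli function is continuous
  have hHc : Continuous (selfSimilarBernoulli (1 / (2 + ρ)) 0 V P') := hprof.contDiff_selfSimilarBernoulli.continuous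
  -- ### the profile is irrotational
  have hcurl : ∀ x : EuclideanSpace ℝ (Fin 3), curl V x = 0 := by
    intro x
    by_contra hxc
    -- the FIXED inner radius and the Bernoulli floor (R47 §1: `ℋ₀` is a number)
    obtain ⟨Rin, hRin⟩ : ∃ Rin : ℝ, Rin = ‖x‖ + 1 := ⟨_, rfl⟩
    have hRin0 : 0 < Rin := by rw [hRin]; positivity
    have hxRin : ‖x‖ < Rin := by rw [hRin]; linarith
    obtain ⟨ymin, hymin, hmin⟩ := (isCompact_closedBall (0 : EuclideanSpace ℝ (Fin 3)) Rin).exists_isMinOn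
      ⟨0, mem_closedBall_self hRin0.le⟩ hHc.continuousOn
    set H₀ : ℝ := selfSimilarBernoulli (1 / (2 + ρ)) 0 V P' ymin with hH₀
    have hfloor : ∀ y ∈ closedBall (0 : EuclideanSpace ℝ (Fin 3)) Rin, H₀ ≤ selfSimilarBernoulli (1 / (2 + ρ)) 0 V P' y :=
      fun y hy => hmin hy
    -- the window hypothesis for this profile, with `M = |ℋ₀ − P'(0)|`
    obtain ⟨R₁, hR₁, hWin⟩ := hW CA CE q θ hCApos hCEpos hq hq2 hθ0 hθ1 V P' hV hprof hbA hbE |H₀ - P' 0| (abs_nonneg _)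
    -- the base radius
    obtain ⟨R, hRdef⟩ : ∃ R : ℝ, R = max (max R₁ 1) (max R₀ Rin) := ⟨_, rfl⟩
    have hRR₁ : R₁ ≤ R := by rw [hRdef]; exact (le_max_left _ _).trans (le_max_left _ _)
    have hR1 : 1 ≤ R := by rw [hRdef]; exact (le_max_right _ _).trans (le_max_left _ _)
    have hRR₀ : R₀ ≤ R := by rw [hRdef]; exact (le_max_left _ _).trans (le_max_right _ _)
    have hRRin : Rin ≤ R := by rw [hRdef]; exact (le_max_right _ _).trans (le_max_right _ _)
    have hR0 : 0 < R := by linarith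
    -- every window `[ℓ, qℓ]`, `ℓ ≥ R`, pays `a ℓ^{1−ρ}`
    have hwin : ∀ ℓ : ℝ, R ≤ ℓ → a * ℓ ^ (1 - ρ) ≤ F (q * ℓ) - F ℓ := by
      intro ℓ hℓ
      have hℓ0 : 0 < ℓ := hR0.trans_le hℓ
      have hℓ1 : 1 ≤ ℓ := hR1.trans hℓ
      have hRinℓ : Rin ≤ ℓ := hRRin.trans hℓ
      have hqℓ : ℓ ≤ q * ℓ := le_mul_of_one_le_left hℓ0.le hq.le
      -- the shell budget `S_ℓ = F(qℓ) − F(ℓ)`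
      have hshell : F (q * ℓ) - F ℓ =
          ∫ z in ball (0 : EuclideanSpace ℝ (Fin 3)) (q * ℓ) ∩ {x | ℓ ≤ ‖x‖}, frobeniusNormSq (fderiv ℝ V z) := by
        rw [← ball_sdiff_ball_eq_shell, setIntegral_sdiff measurableSet_ball (hFint _) (ball_subset_ball hqℓ)]
      have hSℓ0 : 0 ≤ ∫ z in ball (0 : EuclideanSpace ℝ (Fin 3)) (q * ℓ) ∩ {x | ℓ ≤ ‖x‖}, frobeniusNormSq (fderiv ℝ V z) :=
        setIntegral_nonneg (measurableSet_ball.inter (measurableSet_le measurable_const continuous_norm.measurable))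
          fun z _ => frobeniusNormSq_nonneg _
      by_contra hlt
      push Not at hlt
      rw [hshell] at hlt
      obtain ⟨S, hSdef⟩ : ∃ S : ℝ, S =
          ((∫ z in ball (0 : EuclideanSpace ℝ (Fin 3)) (q * ℓ) ∩ {x | ℓ ≤ ‖x‖}, frobeniusNormSq (fderiv ℝ V z)) +
            a * ℓ ^ (1 - ρ)) / 2 := ⟨_, rfl⟩
      have haℓ : 0 < a * ℓ ^ (1 - ρ) := mul_pos hapos (Real.rpow_pos_of_pos hℓ0 _)
      have hS : 0 < S := by rw [hSdef]; linarith
      have hSℓS : (∫ z in ball (0 : EuclideanSpace ℝ (Fin 3)) (q * ℓ) ∩ {x | ℓ ≤ ‖x‖}, frobeniusNormSq (fderiv ℝ V z)) ≤ S := by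
        rw [hSdef]; linarith
      have hSa : S < a * ℓ ^ (1 - ρ) := by rw [hSdef]; linarith
      -- a `C²` cut-off copy agreeing with `V` on `B(0,(q+1)ℓ)`
      obtain ⟨Vc, hVc2, -, -, ⟨K, hK⟩, hVU⟩ := Loc.exists_cutoff_local hV (R := (q + 1) * ℓ) (by positivity)
      have hVc1 : ContDiff ℝ 1 Vc := hVc2.of_le (by norm_num)
      have hsub : ball (0 : EuclideanSpace ℝ (Fin 3)) (q * ℓ) ⊆ ball (0 : EuclideanSpace ℝ (Fin 3)) ((q + 1) * ℓ) :=
        ball_subset_ball (by linarith)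
      have hfd : ∀ z ∈ ball (0 : EuclideanSpace ℝ (Fin 3)) ((q + 1) * ℓ), fderiv ℝ Vc z = fderiv ℝ V z := fun z hz =>
        Filter.EventuallyEq.fderiv_eq (Filter.eventually_of_mem (isOpen_ball.mem_nhds hz) hVU)
      -- an exit from the FIXED ball `B(0,R_in)` through `‖·‖ = qℓ` must exist, else `curl V x = 0`
      have hΛ : 1 < q * ℓ / Rin := by
        rw [lt_div_iff₀ hRin0, one_mul]
        exact hRinℓ.trans_lt (lt_mul_of_one_lt_left hℓ0 hq)
      have hΛR : q * ℓ / Rin * Rin = q * ℓ := div_mul_cancel₀ _ hRin0.ne'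
      have hVU' : ∀ y ∈ ball (0 : EuclideanSpace ℝ (Fin 3)) ((q * ℓ / Rin + 1) * Rin), Vc y = V y := by
        intro y hy
        refine hVU y (ball_subset_ball ?_ hy)
        rw [add_mul, hΛR, one_mul]; linarith
      have hex : ∃ (y : EuclideanSpace ℝ (Fin 3)) (L : ℝ), ‖y‖ < Rin ∧ 0 ≤ L ∧
          q * ℓ ≤ ‖ODE.evolutionMap (fun _ : ℝ => selfSimilarTransport (1 / (2 + ρ)) 0 Vc) 0 (-L) y‖ := by
        by_contra hne
        push Not at hne
        refine hxc (curl_eq_zero_of_noexit hprof hγ hγ2 hV hVc1 hK hRin0 hΛ hVU' (fun y hy L hL => ?_) hxRin)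
        rw [hΛR]; exact hne y L hy hL
      obtain ⟨y, L, hy, hL, hexit⟩ := hex
      have hyℓ : ‖y‖ < ℓ := hy.trans_le hRinℓ
      have hyfloor : H₀ ≤ selfSimilarBernoulli (1 / (2 + ρ)) 0 V P' y := hfloor y (mem_closedBall_zero_iff.2 hy.le)
      -- the per-window count … under the envelope at radius `qℓ`
      obtain ⟨z, hz, hzle⟩ := hWin Vc K H₀ hVc1 hK le_rfl ℓ S (hRR₁.trans hℓ) hS hVU hSℓS y L hL hyℓ hyfloor hexit
      have hqℓ0 : 0 < q * ℓ := by positivity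
      have henv : ‖fderiv ℝ V z‖ ≤ Real.exp (c' * (q * ℓ) ^ (2 + ρ)) := by
        refine (hgrad (q * ℓ) (hRR₀.trans (hℓ.trans hqℓ)) z hz).trans (Real.exp_le_exp.2 ?_)
        exact mul_le_mul_of_nonneg_right hc₀c' (Real.rpow_nonneg hqℓ0.le _)
      have hineq := Real.exp_le_exp.1 (hzle.trans henv)
      rw [Real.mul_rpow hq0.le hℓ0.le, mul_div_assoc', mul_div_assoc', div_le_iff₀ (by positivity : (0 : ℝ) < 3 * S)] at hineq
      -- `a ℓ^{1−ρ} ≤ S`, contradicting `S < a ℓ^{1−ρ}`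
      have hℓ3 : ℓ ^ (2 + ρ) * ℓ ^ (1 - ρ) = ℓ ^ 3 := by
        rw [← Real.rpow_add hℓ0, show (2 + ρ) + (1 - ρ) = ((3 : ℕ) : ℝ) by push_cast; ring, Real.rpow_natCast]
      have hℓQ : 0 < ℓ ^ (2 + ρ) := Real.rpow_pos_of_pos hℓ0 _
      have hfin : a * ℓ ^ (1 - ρ) ≤ S := by
        rw [hadef, div_mul_eq_mul_div, div_le_iff₀ (by positivity)]
        refine le_of_mul_le_mul_right ?_ hℓQ
        calc θ * (β * (2 * Real.pi * (1 / (2 + ρ)) ^ 2 * (q ^ 3 - 1))) * ℓ ^ (1 - ρ) * ℓ ^ (2 + ρ)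
            = θ * (β * (2 * Real.pi * (1 / (2 + ρ)) ^ 2 * (q ^ 3 - 1))) * (ℓ ^ (2 + ρ) * ℓ ^ (1 - ρ)) := by ring
          _ = θ * (β * (2 * Real.pi * (1 / (2 + ρ)) ^ 2 * (q ^ 3 - 1) * ℓ ^ 3)) := by rw [hℓ3]; ring
          _ ≤ c' * (q ^ (2 + ρ) * ℓ ^ (2 + ρ)) * (3 * S) := hineq
          _ = S * (3 * c' * q ^ (2 + ρ)) * ℓ ^ (2 + ρ) := by ring
      linarith
    -- (W2): the windows cannot all be paid from `F(t) ≤ C_E t^{1−ρ}`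
    have hW2 := telescopingBudget_of (F := F) (C := CE) hρ1' hq hR0 (fun t _ => hF0 t)
      (fun t ht => hbE t (hR1.trans ht)) hwin
    rw [hadef] at hW2
    exact thinWindow_absurd_beta hθ0 hβ hq hc'pos hQ hCEpos hρ.le hρ1' hκid hqθ hW2
  -- ### conclusion
  exact Loc.selfSimilar_ae_eq_zero_of_irrotationalC2_profile hρ hsw.distributional hA hu hV hcurl


/-- **THEOREM K⁗ FROM THE PER-WINDOW FROBENIUS COUNT WITH FACTOR `14/9 + ρ`**: the conclusion is
`NsregP2.R47.MomentumGapLiouville` (r47/Sketch47.lean fea44084dd39e0a7) VERBATIM (`E3` spelled out); the hypothesis is the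
per-window count `hW` of `gapLiouville_of_windowCount` at `β = 14/9 + ρ`, for every `ρ ∈ (0,½]`.  K⁗ lands unconditionally the
moment `hW` is a tree theorem (R47 (H47b) + packing). [nsreg-p2 ROUND-47 §3 THEOREM K⁗; cite: ConstantinIgnatovaVicol2026Putative,
§3.4.1; folklore] -/
theorem momentumGapLiouville_of_windowCount
    (hW : ∀ (ρ : ℝ), 0 < ρ → ρ ≤ 1 / 2 → ∀ (C_A C_E q θ : ℝ), 0 < C_A → 0 < C_E → 1 < q → q ≤ 2 → 0 < θ → θ < 1 →
      ∀ (V : EuclideanSpace ℝ (Fin 3) → EuclideanSpace ℝ (Fin 3)) (P : EuclideanSpace ℝ (Fin 3) → ℝ),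
        ContDiff ℝ 2 V → IsSelfSimilarEulerProfile (1 / (2 + ρ)) 0 V P →
        (∀ L : ℝ, 0 < L → ∫ x in ball (0 : EuclideanSpace ℝ (Fin 3)) L, ‖V x‖ ^ 2 ≤ C_A * L ^ (1 - 2 * ρ)) →
        (∀ L : ℝ, 1 ≤ L → ∫ x in ball (0 : EuclideanSpace ℝ (Fin 3)) L, frobeniusNormSq (fderiv ℝ V x) ≤ C_E * L ^ (1 - ρ)) →
        ∀ M : ℝ, 0 ≤ M → ∃ R₁ : ℝ, 0 < R₁ ∧
          ∀ (Vc : EuclideanSpace ℝ (Fin 3) → EuclideanSpace ℝ (Fin 3)) (K H₀ : ℝ), ContDiff ℝ 1 Vc →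
            (∀ y, ‖fderiv ℝ Vc y‖ ≤ K) → |H₀ - P 0| ≤ M →
            ∀ ℓ S : ℝ, R₁ ≤ ℓ → 0 < S →
              (∀ y ∈ ball (0 : EuclideanSpace ℝ (Fin 3)) ((q + 1) * ℓ), Vc y = V y) →
              (∫ x in ball (0 : EuclideanSpace ℝ (Fin 3)) (q * ℓ) ∩ {x : EuclideanSpace ℝ (Fin 3) | ℓ ≤ ‖x‖},
                  frobeniusNormSq (fderiv ℝ V x) ≤ S) →
              ∀ (y : EuclideanSpace ℝ (Fin 3)) (L : ℝ), 0 ≤ L → ‖y‖ < ℓ →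
                H₀ ≤ selfSimilarBernoulli (1 / (2 + ρ)) 0 V P y →
                q * ℓ ≤ ‖ODE.evolutionMap (fun _ : ℝ => selfSimilarTransport (1 / (2 + ρ)) 0 Vc) 0 (-L) y‖ →
                ∃ z ∈ ball (0 : EuclideanSpace ℝ (Fin 3)) (q * ℓ),
                  Real.exp (θ * ((14 / 9 + ρ) * (2 * Real.pi * (1 / (2 + ρ)) ^ 2 * (q ^ 3 - 1) * ℓ ^ 3 / (3 * S)))) ≤
                    ‖fderiv ℝ V z‖) :
    ∀ (ρ : ℝ), 0 < ρ → ρ ≤ 1 / 2 →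
      ∀ (u : ℝ → EuclideanSpace ℝ (Fin 3) → EuclideanSpace ℝ (Fin 3)) (p : ℝ → EuclideanSpace ℝ (Fin 3) → ℝ)
        (H : ℝ → EuclideanSpace ℝ (Fin 3) → EuclideanSpace ℝ (Fin 3) →L[ℝ] EuclideanSpace ℝ (Fin 3)) (c : ℝ≥0), 0 < (c : ℝ) →
        IsSuitableWeakSolutionOn (slab (EuclideanSpace ℝ (Fin 3)) (Iio 0) isOpen_Iio) 0 0 u p →
        HasWeakSpatialGradientOn (slab (EuclideanSpace ℝ (Fin 3)) (Iio 0) isOpen_Iio) u H →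
        (∀ a : ℝ, 0 < a →
          ENNReal.ofReal (a ^ (2 * ρ)) * cknA a (0 : ℝ × EuclideanSpace ℝ (Fin 3)) u +
              ENNReal.ofReal (a ^ ρ) * cknE a (0 : ℝ × EuclideanSpace ℝ (Fin 3)) H +
            ENNReal.ofReal (a ^ (2 * ρ)) * cknD a (0 : ℝ × EuclideanSpace ℝ (Fin 3)) p ≤ (c : ℝ≥0∞)) →
        ∀ (V : EuclideanSpace ℝ (Fin 3) → EuclideanSpace ℝ (Fin 3)) (P : EuclideanSpace ℝ (Fin 3) → ℝ),
          (∀ τ : ℝ, τ < 0 → u τ = selfSimilarCollapse (1 / (2 + ρ)) 0 V τ) →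
          (∀ τ : ℝ, τ < 0 → p τ = selfSimilarCollapsePressure (1 / (2 + ρ)) 0 P τ) →
          ContDiff ℝ 2 V →
          (∃ c' : ℝ, c' < (14 / 9 + ρ) * (2 * Real.pi / ((1 - ρ) ^ 2 * (2 + ρ) * (c : ℝ))) ∧
            ∃ R₀ : ℝ, ∀ R : ℝ, R₀ ≤ R →
              ∀ z ∈ ball (0 : EuclideanSpace ℝ (Fin 3)) R, ‖fderiv ℝ V z‖ ≤ Real.exp (c' * R ^ (2 + ρ))) →
          uncurry u =ᵐ[volume.restrict (Iio (0 : ℝ) ×ˢ (univ : Set (EuclideanSpace ℝ (Fin 3))))] 0 :=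
  fun ρ hρ hρ1 _ _ _ _ hc hsw hH hgauge _ _ hu hp hV hgrad =>
    gapLiouville_of_windowCount hρ hρ1 (by positivity : (0 : ℝ) < 14 / 9 + ρ) (hW ρ hρ hρ1) hc hsw hH hgauge hu hp hV hgrad

end Summit.NavierStokesRegularity.NavierStokesRegularity.Theorems.PowerGaugeEulerLiouville.Condenser

end
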